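import Summits.HubbardSuperconductivity.HubbardSuperconductivity.Theorems.AnisotropyChordSpinMonotoneTwoMagnonRookGraph

/-!
# Route `AnisotropyChord`: neighbour sums of a class-constant two-magnon vector on the rook graph
# (combinatorial toolkit, part 2, for the two-magnon rung TM-VT on `K_m □ K_n`)

For a two-magnon vector on the rook graph `α × β` taking the values `A` on row pairs, `B` on column
pairs and `C` on far pairs (`…TwoMagnonRookGraph`), the neighbour sums that enter
`(H(Δ)ψ)(e_i + e_j)` in pair coordinates (`xxz_mulVec_pair`, reduced by `hopSum_eq_two_mul`) are:
at a row pair `(|α| − 2)·A + (|β| − 1)·C` (`rowPair_hopSum`, `rowPair_hopSum'`), at a column pair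
`(|β| − 2)·B + (|α| − 1)·C` (`colPair_hopSum`, `colPair_hopSum'`), at a far pair
`A + B + (|α| − 2 + |β| − 2)·C` (`farPair_hopSum`, `farPair_hopSum'`) — the `3 × 3` class reduction of
the two-magnon block (theory seat `hubbard-h0-rotor-theory-1`, cycle 5, rook family / equitable
quotient).  No definition is introduced.
-/

set_option linter.dupNamespace false

noncomputable section

namespace Summit.HubbardSuperconductivity.HubbardSuperconductivity.Theorems.AnisotropyChord.TwoMagnon

open Matrix Complex Finset

variable {α β : Type*} [Fintype α] [DecidableEq α] [Fintype β] [DecidableEq β]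
variable {G : SimpleGraph (α × β)} [DecidableRel G.Adj] {f : (α × β → Fin 2) → ℂ}

/-- **Neighbour sum at a row pair, `i`-side**: `(|α| − 2)·A + (|β| − 1)·C`. [folklore] -/
theorem rowPair_hopSum
    (hadj : ∀ x y : α × β, G.Adj x y ↔ (x.1 ≠ y.1 ∧ x.2 = y.2) ∨ (x.1 = y.1 ∧ x.2 ≠ y.2))
    {A C : ℂ}
    (hA : ∀ x y : α × β, x.1 ≠ y.1 → x.2 = y.2 → f (Pi.single x 1 + Pi.single y 1) = A)
    (hC : ∀ x y : α × β, x.1 ≠ y.1 → x.2 ≠ y.2 → f (Pi.single x 1 + Pi.single y 1) = C)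
    {i j : α × β} (h1 : i.1 ≠ j.1) (h2 : i.2 = j.2) :
    (∑ y, if y = i ∨ y = j then 0 else
        if G.Adj i y then f (Pi.single y 1 + Pi.single j 1) else 0) =
      ((Fintype.card α : ℂ) - 2) * A + ((Fintype.card β : ℂ) - 1) * C := by
  have hij : i ≠ j := fun h => h1 (by rw [h])
  have hrw : ∀ y, (if y = i ∨ y = j then (0 : ℂ) else
      if G.Adj i y then f (Pi.single y 1 + Pi.single j 1) else 0) =
      (if G.Adj i y then (if y = i ∨ y = j then 0 else f (Pi.single y 1 + Pi.single j 1)) else 0) := by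
    intro y
    by_cases hy : (y = i ∨ y = j)
    · simp [hy]
    · simp [hy]
  simp_rw [hrw]
  rw [rook_sum_adj hadj i]
  congr 1
  · have h : ∀ a : α, (if a = i.1 then (0 : ℂ) else
        if ((a, i.2) = i ∨ (a, i.2) = j) then 0 else f (Pi.single (a, i.2) 1 + Pi.single j 1)) =
        if a = i.1 ∨ a = j.1 then 0 else A := by
      intro a
      by_cases ha : a = i.1
      · simp [ha]
      · by_cases ha' : a = j.1
        · subst ha'
          have : ((j.1, i.2) : α × β) = j := Prod.ext rfl h2
          simp [this]
        · have hi : ((a, i.2) : α × β) ≠ i := fun h => ha (congrArg Prod.fst h)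
          have hj : ((a, i.2) : α × β) ≠ j := fun h => ha' (congrArg Prod.fst h)
          rw [if_neg ha, if_neg (not_or.mpr ⟨hi, hj⟩), if_neg (not_or.mpr ⟨ha, ha'⟩)]
          exact hA _ _ ha' h2
    simp_rw [h]
    exact sum_ite_or_eq_else (fun h => h1 h) A
  · have h : ∀ b : β, (if b = i.2 then (0 : ℂ) else
        if ((i.1, b) = i ∨ (i.1, b) = j) then 0 else f (Pi.single (i.1, b) 1 + Pi.single j 1)) =
        if b = i.2 then 0 else C := by
      intro b
      by_cases hb : b = i.2
      · simp [hb]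
      · have hi : ((i.1, b) : α × β) ≠ i := fun h => hb (congrArg Prod.snd h)
        have hj : ((i.1, b) : α × β) ≠ j := fun h => h1 (congrArg Prod.fst h : ((i.1, b) : α × β).1 = j.1)
        rw [if_neg hb, if_neg (not_or.mpr ⟨hi, hj⟩), if_neg hb]
        exact hC _ _ h1 (by rw [← h2]; exact hb)
    simp_rw [h]
    exact sum_ite_eq_else i.2 C

/-- **Neighbour sum at a row pair, `j`-side**: the same count. [folklore] -/
theorem rowPair_hopSum'
    (hadj : ∀ x y : α × β, G.Adj x y ↔ (x.1 ≠ y.1 ∧ x.2 = y.2) ∨ (x.1 = y.1 ∧ x.2 ≠ y.2))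
    {A C : ℂ}
    (hA : ∀ x y : α × β, x.1 ≠ y.1 → x.2 = y.2 → f (Pi.single x 1 + Pi.single y 1) = A)
    (hC : ∀ x y : α × β, x.1 ≠ y.1 → x.2 ≠ y.2 → f (Pi.single x 1 + Pi.single y 1) = C)
    {i j : α × β} (h1 : i.1 ≠ j.1) (h2 : i.2 = j.2) :
    (∑ y, if y = i ∨ y = j then 0 else
        if G.Adj j y then f (Pi.single i 1 + Pi.single y 1) else 0) =
      ((Fintype.card α : ℂ) - 2) * A + ((Fintype.card β : ℂ) - 1) * C := by
  have h := rowPair_hopSum (f := f) hadj (A := A) (C := C)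
    (fun x y hx hy => by rw [pair_comm]; exact hA y x (Ne.symm hx) hy.symm)
    (fun x y hx hy => by rw [pair_comm]; exact hC y x (Ne.symm hx) (Ne.symm hy))
    (i := j) (j := i) (Ne.symm h1) h2.symm
  rw [← h]
  refine Finset.sum_congr rfl fun y _ => ?_
  rw [pair_comm y i]
  by_cases hy : (y = i ∨ y = j)
  · rw [if_pos hy, if_pos hy.symm]
  · rw [if_neg hy, if_neg (show ¬ (y = j ∨ y = i) from fun h' => hy h'.symm)]

/-- **Neighbour sum at a column pair, `i`-side**: `(|β| − 2)·B + (|α| − 1)·C`. [folklore] -/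
theorem colPair_hopSum
    (hadj : ∀ x y : α × β, G.Adj x y ↔ (x.1 ≠ y.1 ∧ x.2 = y.2) ∨ (x.1 = y.1 ∧ x.2 ≠ y.2))
    {B C : ℂ}
    (hB : ∀ x y : α × β, x.1 = y.1 → x.2 ≠ y.2 → f (Pi.single x 1 + Pi.single y 1) = B)
    (hC : ∀ x y : α × β, x.1 ≠ y.1 → x.2 ≠ y.2 → f (Pi.single x 1 + Pi.single y 1) = C)
    {i j : α × β} (h1 : i.1 = j.1) (h2 : i.2 ≠ j.2) :
    (∑ y, if y = i ∨ y = j then 0 else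
        if G.Adj i y then f (Pi.single y 1 + Pi.single j 1) else 0) =
      ((Fintype.card β : ℂ) - 2) * B + ((Fintype.card α : ℂ) - 1) * C := by
  have hrw : ∀ y, (if y = i ∨ y = j then (0 : ℂ) else
      if G.Adj i y then f (Pi.single y 1 + Pi.single j 1) else 0) =
      (if G.Adj i y then (if y = i ∨ y = j then 0 else f (Pi.single y 1 + Pi.single j 1)) else 0) := by
    intro y
    by_cases hy : (y = i ∨ y = j)
    · simp [hy]
    · simp [hy]
  simp_rw [hrw]
  rw [rook_sum_adj hadj i, add_comm]
  congr 1
  · have h : ∀ b : β, (if b = i.2 then (0 : ℂ) else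
        if ((i.1, b) = i ∨ (i.1, b) = j) then 0 else f (Pi.single (i.1, b) 1 + Pi.single j 1)) =
        if b = i.2 ∨ b = j.2 then 0 else B := by
      intro b
      by_cases hb : b = i.2
      · simp [hb]
      · by_cases hb' : b = j.2
        · subst hb'
          have : ((i.1, j.2) : α × β) = j := Prod.ext h1 rfl
          simp [this]
        · have hi : ((i.1, b) : α × β) ≠ i := fun h => hb (congrArg Prod.snd h)
          have hj : ((i.1, b) : α × β) ≠ j := fun h => hb' (congrArg Prod.snd h)
          rw [if_neg hb, if_neg (not_or.mpr ⟨hi, hj⟩), if_neg (not_or.mpr ⟨hb, hb'⟩)]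
          exact hB _ _ h1 hb'
    simp_rw [h]
    exact sum_ite_or_eq_else (fun h => h2 h) B
  · have h : ∀ a : α, (if a = i.1 then (0 : ℂ) else
        if ((a, i.2) = i ∨ (a, i.2) = j) then 0 else f (Pi.single (a, i.2) 1 + Pi.single j 1)) =
        if a = i.1 then 0 else C := by
      intro a
      by_cases ha : a = i.1
      · simp [ha]
      · have hi : ((a, i.2) : α × β) ≠ i := fun h => ha (congrArg Prod.fst h)
        have hj : ((a, i.2) : α × β) ≠ j := fun h => h2 (congrArg Prod.snd h : ((a, i.2) : α × β).2 = j.2)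
        rw [if_neg ha, if_neg (not_or.mpr ⟨hi, hj⟩), if_neg ha]
        exact hC _ _ (by rw [← h1]; exact ha) h2
    simp_rw [h]
    exact sum_ite_eq_else i.1 C

/-- **Neighbour sum at a column pair, `j`-side**. [folklore] -/
theorem colPair_hopSum'
    (hadj : ∀ x y : α × β, G.Adj x y ↔ (x.1 ≠ y.1 ∧ x.2 = y.2) ∨ (x.1 = y.1 ∧ x.2 ≠ y.2))
    {B C : ℂ}
    (hB : ∀ x y : α × β, x.1 = y.1 → x.2 ≠ y.2 → f (Pi.single x 1 + Pi.single y 1) = B)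
    (hC : ∀ x y : α × β, x.1 ≠ y.1 → x.2 ≠ y.2 → f (Pi.single x 1 + Pi.single y 1) = C)
    {i j : α × β} (h1 : i.1 = j.1) (h2 : i.2 ≠ j.2) :
    (∑ y, if y = i ∨ y = j then 0 else
        if G.Adj j y then f (Pi.single i 1 + Pi.single y 1) else 0) =
      ((Fintype.card β : ℂ) - 2) * B + ((Fintype.card α : ℂ) - 1) * C := by
  have h := colPair_hopSum (f := f) hadj (B := B) (C := C)
    (fun x y hx hy => by rw [pair_comm]; exact hB y x hx.symm (Ne.symm hy))
    (fun x y hx hy => by rw [pair_comm]; exact hC y x (Ne.symm hx) (Ne.symm hy))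
    (i := j) (j := i) h1.symm (Ne.symm h2)
  rw [← h]
  refine Finset.sum_congr rfl fun y _ => ?_
  rw [pair_comm y i]
  by_cases hy : (y = i ∨ y = j)
  · rw [if_pos hy, if_pos hy.symm]
  · rw [if_neg hy, if_neg (show ¬ (y = j ∨ y = i) from fun h' => hy h'.symm)]

/-- **Neighbour sum at a far pair, `i`-side**: `A + B + (|α| − 2 + |β| − 2)·C`. [folklore] -/
theorem farPair_hopSum
    (hadj : ∀ x y : α × β, G.Adj x y ↔ (x.1 ≠ y.1 ∧ x.2 = y.2) ∨ (x.1 = y.1 ∧ x.2 ≠ y.2))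
    {A B C : ℂ}
    (hA : ∀ x y : α × β, x.1 ≠ y.1 → x.2 = y.2 → f (Pi.single x 1 + Pi.single y 1) = A)
    (hB : ∀ x y : α × β, x.1 = y.1 → x.2 ≠ y.2 → f (Pi.single x 1 + Pi.single y 1) = B)
    (hC : ∀ x y : α × β, x.1 ≠ y.1 → x.2 ≠ y.2 → f (Pi.single x 1 + Pi.single y 1) = C)
    {i j : α × β} (h1 : i.1 ≠ j.1) (h2 : i.2 ≠ j.2) :
    (∑ y, if y = i ∨ y = j then 0 else
        if G.Adj i y then f (Pi.single y 1 + Pi.single j 1) else 0) =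
      A + B + (((Fintype.card α : ℂ) - 2) + ((Fintype.card β : ℂ) - 2)) * C := by
  have hrw : ∀ y, (if y = i ∨ y = j then (0 : ℂ) else
      if G.Adj i y then f (Pi.single y 1 + Pi.single j 1) else 0) =
      (if G.Adj i y then (if y = i ∨ y = j then 0 else f (Pi.single y 1 + Pi.single j 1)) else 0) := by
    intro y
    by_cases hy : (y = i ∨ y = j)
    · simp [hy]
    · simp [hy]
  simp_rw [hrw]
  rw [rook_sum_adj hadj i]
  have ha : (∑ a : α, if a = i.1 then (0 : ℂ) else
      if ((a, i.2) = i ∨ (a, i.2) = j) then 0 else f (Pi.single (a, i.2) 1 + Pi.single j 1)) =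
      B + ((Fintype.card α : ℂ) - 2) * C := by
    have h : ∀ a : α, (if a = i.1 then (0 : ℂ) else
        if ((a, i.2) = i ∨ (a, i.2) = j) then 0 else f (Pi.single (a, i.2) 1 + Pi.single j 1)) =
        if a = i.1 then 0 else if a = j.1 then B else C := by
      intro a
      by_cases ha : a = i.1
      · simp [ha]
      · have hi : ((a, i.2) : α × β) ≠ i := fun h => ha (congrArg Prod.fst h)
        have hj : ((a, i.2) : α × β) ≠ j := fun h => h2 (congrArg Prod.snd h : ((a, i.2) : α × β).2 = j.2)
        rw [if_neg ha, if_neg (not_or.mpr ⟨hi, hj⟩), if_neg ha]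
        by_cases ha' : a = j.1
        · rw [if_pos ha']
          exact hB _ _ ha' h2
        · rw [if_neg ha']
          exact hC _ _ ha' h2
    simp_rw [h]
    exact sum_ite_eq_else_ite h1 B C
  have hb : (∑ b : β, if b = i.2 then (0 : ℂ) else
      if ((i.1, b) = i ∨ (i.1, b) = j) then 0 else f (Pi.single (i.1, b) 1 + Pi.single j 1)) =
      A + ((Fintype.card β : ℂ) - 2) * C := by
    have h : ∀ b : β, (if b = i.2 then (0 : ℂ) else
        if ((i.1, b) = i ∨ (i.1, b) = j) then 0 else f (Pi.single (i.1, b) 1 + Pi.single j 1)) =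
        if b = i.2 then 0 else if b = j.2 then A else C := by
      intro b
      by_cases hb : b = i.2
      · simp [hb]
      · have hi : ((i.1, b) : α × β) ≠ i := fun h => hb (congrArg Prod.snd h)
        have hj : ((i.1, b) : α × β) ≠ j := fun h => h1 (congrArg Prod.fst h : ((i.1, b) : α × β).1 = j.1)
        rw [if_neg hb, if_neg (not_or.mpr ⟨hi, hj⟩), if_neg hb]
        by_cases hb' : b = j.2
        · rw [if_pos hb']
          exact hA _ _ h1 hb'
        · rw [if_neg hb']
          exact hC _ _ h1 hb'
    simp_rw [h]
    exact sum_ite_eq_else_ite h2 A C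
  rw [ha, hb]
  ring

/-- **Neighbour sum at a far pair, `j`-side**. [folklore] -/
theorem farPair_hopSum'
    (hadj : ∀ x y : α × β, G.Adj x y ↔ (x.1 ≠ y.1 ∧ x.2 = y.2) ∨ (x.1 = y.1 ∧ x.2 ≠ y.2))
    {A B C : ℂ}
    (hA : ∀ x y : α × β, x.1 ≠ y.1 → x.2 = y.2 → f (Pi.single x 1 + Pi.single y 1) = A)
    (hB : ∀ x y : α × β, x.1 = y.1 → x.2 ≠ y.2 → f (Pi.single x 1 + Pi.single y 1) = B)
    (hC : ∀ x y : α × β, x.1 ≠ y.1 → x.2 ≠ y.2 → f (Pi.single x 1 + Pi.single y 1) = C)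
    {i j : α × β} (h1 : i.1 ≠ j.1) (h2 : i.2 ≠ j.2) :
    (∑ y, if y = i ∨ y = j then 0 else
        if G.Adj j y then f (Pi.single i 1 + Pi.single y 1) else 0) =
      A + B + (((Fintype.card α : ℂ) - 2) + ((Fintype.card β : ℂ) - 2)) * C := by
  have h := farPair_hopSum (f := f) hadj (A := A) (B := B) (C := C)
    (fun x y hx hy => by rw [pair_comm]; exact hA y x (Ne.symm hx) hy.symm)
    (fun x y hx hy => by rw [pair_comm]; exact hB y x hx.symm (Ne.symm hy))
    (fun x y hx hy => by rw [pair_comm]; exact hC y x (Ne.symm hx) (Ne.symm hy))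
    (i := j) (j := i) (Ne.symm h1) (Ne.symm h2)
  rw [← h]
  refine Finset.sum_congr rfl fun y _ => ?_
  rw [pair_comm y i]
  by_cases hy : (y = i ∨ y = j)
  · rw [if_pos hy, if_pos hy.symm]
  · rw [if_neg hy, if_neg (show ¬ (y = j ∨ y = i) from fun h' => hy h'.symm)]


end Summit.HubbardSuperconductivity.HubbardSuperconductivity.Theorems.AnisotropyChord.TwoMagnon
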